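import Summits.ResolutionOfSingularities.ResolutionOfSingularities.Theorems.RadicialJungCleanModelsCleanLU3CompositeCdiv
import Summits.ResolutionOfSingularities.ResolutionOfSingularities.Theorems.RadicialJungCleanModelsCcurveRebaseD2
import Summits.ResolutionOfSingularities.ResolutionOfSingularities.Theorems.RadicialJungCleanModelsCcurvePersistForm2
import Summits.ResolutionOfSingularities.ResolutionOfSingularities.Theorems.RadicialJungCleanModelsCcurvePointPrepWeak
import Summits.ResolutionOfSingularities.ResolutionOfSingularities.Theorems.RadicialJungCleanModelsCcurveCentreCurveOf
import Summits.ResolutionOfSingularities.ResolutionOfSingularities.Theorems.RadicialJungCleanModelsCcurveLiftOf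
import Summits.ResolutionOfSingularities.ResolutionOfSingularities.Theorems.RadicialJungCleanModelsCcurvePersistForm1
import Summits.ResolutionOfSingularities.ResolutionOfSingularities.Theorems.RadicialJungCleanModelsCcurvePersistForm3
import Summits.ResolutionOfSingularities.ResolutionOfSingularities.Theorems.RadicialJungCleanModelsCcurveRegFinal
import Literature.AlgebraicGeometry.Resolution.ResolutionOfSingularities
import Literature.AlgebraicGeometry.Resolution.QuadraticTransforms
import Literature.AlgebraicGeometry.Resolution.EmbeddedResolutionExcellentSurfaces
import HarnessLib

/-!
# (C-curve) ASSEMBLY SKELETON v3.0 — next sub-line of `stub_cleanLU3DefectNonDiscrete` (:249‴; crux stmt-ResolutionOfSingularities-15917, line `Sketch` rev 28)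

Lead `res-B-lead-1` g6 (2026-08-29).  OURS; nothing here proves resolution in characteristic `p`; resolution in char `p` is NOT proved.  CRUX WORKFILE
(sorries allowed), NOT a registered skeleton: the registered research stub stays ONE (`stub_cleanLU3DefectNonDiscrete`).  Plan of record:
`Lines/Sketch-memo-Ccurve-plan.md` (crux fa29d0b8b98e): the COMPOSITE part of :249‴ over a PERFECT ground field — HYP ∧ `PerfectField k` ∧
(∃ `O₁`, `O < O₁ < K`) — is elementary modulo the registered printed stubs F-02 (`CossartPiltant2019`) and F-32 (`CossartJannsenSaito2020Embedded`).

**v3.0 (lead g7): ALL STUBS CLOSED — ZERO `sorry`.  The last one, the S3-core `stub_Cc_curveRegularize`, is `:= Ccurve.stub_Cc_curveRegularize_of hEmb` over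
✓ `Theorems/RadicialJungCleanModelsCcurveRegFinal.lean` (`Ccurve.curveRegularize`, CLASSICAL AND F-32-FREE: quadratic transforms along `O` inside `locAtCentre B O₁`
(✓ `…CcurveRegInside`), their residues in `κ(R₁)` = the quadratic sequence of `S/𝔮` along the residue valuation ring of `O` (✓ `…CcurveRegResidue/RegImage/RegStep`),
E. Noether ✓ `module_finite_integralClosure_of_essFiniteType` + Herrmann–Ikeda–Orbanz ✓ `exists_sequence_eq_valuationSubring` with ✓ `…CcurveRegHIO` ⇒ `S_c/𝔮_c ≅ V̄`
a DVR); so the `hEmb` binder of the stub is no longer used and F-32 does NOT enter the (C-curve) slice: the target below is kernel-closed MODULO F-02 ONLY, and is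
landed def-free as ✓ `Theorems/RadicialJungCleanModelsCcurveMain.lean` (`Ccurve.cleanLU3Defect_of_properCoarsening_perfect (hCP : CossartPiltant2019)`, over
✓ `…CcurveAssembly.lean`).  Sketch rev 29 narrows :249‴ by `¬(PerfectField k ∧ ∃ O₁, O ≤ O₁ ∧ O₁ ≠ O ∧ O₁ ≠ ⊤)`.**  v2.9 (lead g7): `stub_Cc_persistForm1` and `stub_Cc_persistForm3` are CLOSED modulo S3 — `:= Ccurve.persistForm1_of (stub_Cc_centreCurve hEmb)` (✓ `Theorems/RadicialJungCleanModelsCcurvePersistForm1.lean`)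
and `:= Ccurve.persistForm3_of (stub_Cc_centreCurve hEmb)` (✓ `…CcurvePersistForm3.lean`), over the persist infrastructure ✓ `…CcurvePersistPrelims/Conormal/Pack/Upstairs/One/Two.lean`
(DVR decomposition off the curve, conormal lemma at `S₁`, point blow-ups via ✓ `pointPrep_weak`, tangent normal form `x̃^{a₀}(x̃ + z^{g′}ỹ)^{a₁}` and the Γ-rounds as ONE call of
✓ `exists_model_rsop_div_pow`, exponent of `z` reduced mod `p`; output always FORM (1)).  ONE sorry remains: `stub_Cc_curveRegularize` (S3-core, mod F-32) — the whole perfect-`k`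
composite slice of :249‴ now hangs on it (+ F-02 + F-32).**  v2.8: `stub_Cc_lift` is CLOSED modulo S3 — `:= Ccurve.lift_of (stub_Cc_centreCurve hEmb)` (✓ `Theorems/RadicialJungCleanModelsCcurveLiftOf.lean` over ✓ `…CcurveLiftStep.lean`:
Abhyankar's factorisation + the curve blow-up chart realising each quadratic transform along `O₁` + Huneke–Swanson 14.5.2 for dimension 2); 3 sorries remain
(curveRegularize = S3-core, persistForm1, persistForm3): EVERY remaining use of F-32 funnels through the single geometric stub `stub_Cc_curveRegularize`.  v2.7: the shared stub S3 `stub_Cc_centreCurve` becomes a NODE `:= Ccurve.centreCurve_of (stub_Cc_curveRegularize hEmb)` (✓ `Theorems/RadicialJungCleanModelsCcurveCentreCurveOf.lean` over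
✓ `…CcurveCentreIdealRsp.lean`, Matsumura 14.2): its research content is RE-CUT to the NEW smaller stub `stub_Cc_curveRegularize (hEmb)` = the geometric core (after blow-ups
inside `locAtCentre B O₁` the centre curve of `O₁` is regular at the centre of `O`); 4 sorries (curveRegularize, lift, persistForm1, persistForm3).  v2.6: the shared helper stub `stub_Cc_pointPrep` is RESHAPED to the landed weak form and CLOSED — `:= Ccurve.pointPrep_weak` (✓ `Theorems/RadicialJungCleanModelsCcurvePointPrepWeak.lean`);
4 sorries remain (lift, persistForm1/3, shared centreCurve).  v2.5: `stub_Cc_persistForm2` is CLOSED modulo the shared stub `stub_Cc_centreCurve` — `:= Ccurve.persistForm2_of (stub_Cc_centreCurve hEmb)` with ✓ `Ccurve.persistForm2_of`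
(`Theorems/RadicialJungCleanModelsCcurvePersistForm2.lean`, lead g6, over ✓PersistForm2Alg/✓PointPrepWeak/✓ResiduePerfect/✓PDegreeRepLoc); the shared-stub section now precedes the
delegable stubs; 5 sorries remain (lift, persistForm1/3, shared centreCurve, pointPrep).  v2.4: `stub_Cc_rebaseD2` is LANDED — ✓ `Ccurve.rebaseD2` (`Theorems/RadicialJungCleanModelsCcurveRebaseD2.lean`, lead g6, over ✓CoarseCentre/✓RebaseField/✓RebaseHzd/
✓ModelWithT) and used BY NAME; 6 sorries remain (lift, persistForm1/2/3, shared centreCurve, pointPrep).  v2.3: the S5d caveat of DR-E24 gate (1) is typed into `stub_Cc_persistForm1`'s docstring (statements unchanged).  v2.2: the three persist stubs (and the nodes) also receive `ringKrullDim (locAtCentre B O₁) = 2` (supplied by the lift).  v2.1: + two SHARED helper stubs `stub_Cc_centreCurve` (S3, → porter 2) and `stub_Cc_pointPrep` (S5₀, → porter 3) with pinned signatures (section at the end;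
not wired into the composition).  v2 (same day): FIVE DELEGABLE STUBS and the kernel-checked composition** (v1 = two stubs `liftedD2` / `persist`, now derived nodes):
* `stub_Cc_rebaseD2` (S0+S1; M; mod F-02): a model `B ⊇ A` inside `O`, regular of dim 3 at the centre of `O`, whose local ring at the centre of `O₁` is regular of
  dim 2 with fraction field `K` (the centre of `v₁` is a CURVE: use F-02 once to have `t ∈ B` with `v₁(t) = 0 < v(t)`, `t̄` transcendental), AND a 2-dimensional
  regular local ring `R₁`, `locAtCentre B O₁ ≤ R₁ ≤ O₁` (dominations), carrying a loosely clean representative — ✓ `stub_cleanLU2` over the rebased field `k(t)`,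
  at which `O₁` is zero-dimensional.
* `stub_Cc_lift` (S2+S3+S4; M–L; mod F-32 on curves): realize `R₁` as `locAtCentre B′ O₁` of a model `B′ ⊇ B` regular of dim 3 at the centre of `O` —
  ✓ `AbhyankarQuadraticFactorization_holds` + (regularize the centre curve by F-32, iso at its generic point) + (blow up the regular curve: ✓ `curveChart_step`).
* `stub_Cc_persistForm1` / `stub_Cc_persistForm2` / `stub_Cc_persistForm3` (S5 cut by the form found at `locAtCentre B O₁`; M / M / S–M; Form2 uses
  `PerfectField k` through ✓ `Ccurve.exists_sub_pow_eq_unit_mul_pow` (brick `…CcurveUnitCase`, ⊙ p725573) and ✓ `finrank_frobenius_residueField_eq_pow`;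
  Form1 contains the tangent two-factor case (blow up `Γ = V(x̃, z)`); all three use point blow-ups along `O` and F-32 on the centre curve).
* nodes: `liftedD2_of_stubs`, `persist_of_stubs`, and THE TARGET `cleanLU3Defect_of_properCoarsening_perfect` (statement unchanged from v1).
Sketch rev 29 (when the target is sorry-free): :249 narrowed by `¬(PerfectField k ∧ ∃ O₁, O ≤ O₁ ∧ O₁ ≠ O ∧ O₁ ≠ ⊤)`.
-/

noncomputable section

set_option linter.dupNamespace false

open IsLocalRing AlgebraicGeometry CategoryTheory
open Literature.AlgebraicGeometry.Resolution

namespace Summit.ResolutionOfSingularities.ResolutionOfSingularities.Theorems.RadicialJung.CleanModels.Ccurve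

/-- NODE (LANDED ✓ `Ccurve.rebaseD2`, lead g6; formerly STUB S0+S1, mod F-02 `hCP`; plan §1 S0/S1): **rebased D2** — a model `B ⊇ A` inside `O`, regular of dimension 3 at the centre of `O`, whose local
ring `locAtCentre B O₁` at the centre of the proper coarsening `O₁` is regular of dimension 2 with fraction field `K` (the centre of `v₁` on `Spec B` is a curve),
and a 2-dimensional regular local ring `R₁` between `locAtCentre B O₁` and `O₁` (dominations) at which the `K^p`-line of `g₀` has a loosely clean representative.
Route: `t ∈ O`, `v₁(t) = 0 < v(t)`, `t̄` transcendental over `k` in `κ(O₁)` (tr.deg `κ(O₁)` = 1 by «no divisorial coarsening» + `O₁ ≠ O`); F-02 on `Spec A[t]` +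
✓ `exists_model_of_proper_birational` ⇒ `B ∋ t` regular at the centre; rebase over `F = k(t)`: `B·F` is an `F`-model with the same local ring at the centre of
`O₁`, `O₁` is zero-dimensional over `F`, so ✓ `stub_cleanLU2 p hp F K O₁ (B·F) …` gives `R₁`. [folklore] -/
theorem stub_Cc_rebaseD2 (hCP : CossartPiltant2019.{0}) :
    ∀ (p : ℕ), p.Prime →
    ∀ (k : Type) [Field k] [CharP k p] [PerfectField k] (K : Type) [Field K] [Algebra k K]
    (O : ValuationSubring K) (A : Subalgebra k K), A.toSubring ≤ O.toSubring → A.FG → IsFractionRing A K →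
    ringKrullDim A ≤ 3 → IsRegularLocalRing (locAtCentre A.toSubring O) →
    ringKrullDim (locAtCentre A.toSubring O) = 3 →
    (∀ (T : Subring K) (hT : T ≤ O.toSubring), A.toSubring ≤ T → (subringCentre T O hT).IsMaximal) →
    ∀ g₀ : K, (∀ c : K, c ^ p ≠ g₀) →
    ¬ (∃ (O₁ : ValuationSubring K), O ≤ O₁ ∧ O₁ ≠ ⊤ ∧ ∃ y : Fin 2 → K, (∀ i, y i ∈ O) ∧
      ∀ P : MvPolynomial (Fin 2) k, P ≠ 0 → O₁.valuation (MvPolynomial.aeval y P) = 1) →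
    ∀ (O₁ : ValuationSubring K), O ≤ O₁ → O₁ ≠ O → O₁ ≠ ⊤ →
    ∃ (B : Subalgebra k K), B.toSubring ≤ O.toSubring ∧ A ≤ B ∧ B.FG ∧
    IsRegularLocalRing (locAtCentre B.toSubring O) ∧ ringKrullDim (locAtCentre B.toSubring O) = 3 ∧
    IsRegularLocalRing (locAtCentre B.toSubring O₁) ∧ ringKrullDim (locAtCentre B.toSubring O₁) = 2 ∧
    IsLocalRingOf (locAtCentre B.toSubring O₁) ∧
    ∃ (R₁ : Subring K), R₁ ≤ O₁.toSubring ∧ SubringDominates (locAtCentre B.toSubring O₁) R₁ ∧ SubringDominates R₁ O₁.toSubring ∧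
    ringKrullDim ↥R₁ = 2 ∧
    ∃ (_ : IsRegularLocalRing ↥R₁) (c : Fin p → K), (∃ j : Fin p, (j : ℕ) ≠ 0 ∧ c j ≠ 0) ∧
    ((∃ (d m : ℕ) (hmd : m ≤ d) (t : Fin d → ↥R₁) (a : Fin m → ℕ) (u : ↥R₁), IsUnit u ∧
    Ideal.span (Set.range t) = IsLocalRing.maximalIdeal ↥R₁ ∧
    ringKrullDim ↥R₁ = (d : WithBot ℕ∞) ∧ 0 < m ∧ (∀ i, ¬ p ∣ a i) ∧
    (∑ j : Fin p, c j ^ p * g₀ ^ (j : ℕ)) = (u : K) * ∏ i : Fin m, ((t (Fin.castLE hmd i) : ↥R₁) : K) ^ (a i)) ∨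
    (∃ u : ↥R₁, IsUnit u ∧ (∑ j : Fin p, c j ^ p * g₀ ^ (j : ℕ)) = (u : K) ∧
    ∀ c' : ↥R₁, u - c' ^ p ∉ IsLocalRing.maximalIdeal ↥R₁) ∨
    (∃ s c' : ↥R₁, (∑ j : Fin p, c j ^ p * g₀ ^ (j : ℕ)) = (s : K) ∧
    s - c' ^ p ∈ IsLocalRing.maximalIdeal ↥R₁ ∧
    s - c' ^ p ∉ IsLocalRing.maximalIdeal ↥R₁ ^ 2)) :=
  Ccurve.rebaseD2 hCP

/-! ## v2.1 — SHARED HELPER STUBS (interfaces pinned by the lead; since v2.5 placed BEFORE the delegable stubs because `stub_Cc_persistForm2` uses S3 by name; each porter lands the one assigned to it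
FIRST, as its own `Theorems/RadicialJungCleanModelsCcurve<Name>.lean --supports 15917 --as helper`, and the persist / lift files import them) -/

/-- NODE since v3.0 (✓ `Ccurve.stub_Cc_curveRegularize_of` = ✓ `Ccurve.curveRegularize`, lead g7, CLASSICAL and F-32-free — the `hEmb` binder is kept for the registered interface but unused; formerly SHARED STUB S3-core, NEW in v2.7, OURS, M): **the centre curve made regular at the centre
of `O` by blow-ups inside `locAtCentre B O₁`.**  For a model `B` (f.g., inside `O`, above the base model `A` whose centres are all closed) regular of dimension 3 at
the centre `P` of `O`, and a coarsening `O₁` of `O` whose local ring on `B` has dimension 2 (the centre of `v₁` is a curve `C ∋ P`): a model `B′` with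
`B ≤ B′ ≤ locAtCentre B O₁` (so the local ring at the centre of `O₁` is unchanged), f.g., inside `O`, regular of dimension 3 at the centre of `O`, such that the
centre `𝔮′` of `O₁` on `S′ = locAtCentre B′ O` has a REGULAR quotient `S′/𝔮′` of dimension `1` (the strict transform of `C` is regular at the point followed by `O`).
Route: F-32 = `hEmb` (CJS Thm. 1.4 with `dim X = 1`) applied to the reduced closure `C` of the centre of `O₁` in a regular affine neighbourhood `Spec B_h` of `P`
(✓ `exists_regularAffineModel₃` pattern, excellence ✓ `isExcellentRing_of_finiteType_field`), `π` an isomorphism over the generic point of `C`; extract the model at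
the centre of `O` (✓ `exists_model_of_proper_birational`); every blown-up centre lies over closed points of `C`, so the chart containing the centre of `O` is generated
by quotients with `v₁`-unit denominators, i.e. stays inside `locAtCentre B O₁`.  Classical alternative (no CJS): finitely many quadratic transforms along `O`
(✓ `exists_quadraticSeq_package`; `t_i ∉ 𝔮_i` because `v`-minimal elements of `𝔪_i` lie off `𝔮_i`) until the local ring `S_n/𝔮_n` of the strict transform, which
grows inside the (finite: excellence) normalisation of `S/𝔮`, is regular. [folklore; cite: CossartJannsenSaito2020, Thm. 1.4] -/
theorem stub_Cc_curveRegularize (hEmb : CossartJannsenSaito2020Embedded.{0}) :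
    ∀ (k : Type) [Field k] (K : Type) [Field K] [Algebra k K]
    (O : ValuationSubring K) (A : Subalgebra k K), A.toSubring ≤ O.toSubring → A.FG → IsFractionRing A K → ringKrullDim A ≤ 3 →
    (∀ (T : Subring K) (hT : T ≤ O.toSubring), A.toSubring ≤ T → (subringCentre T O hT).IsMaximal) →
    ∀ (B : Subalgebra k K) (hBO : B.toSubring ≤ O.toSubring), A ≤ B → B.FG →
    IsRegularLocalRing (locAtCentre B.toSubring O) → ringKrullDim (locAtCentre B.toSubring O) = 3 →
    ∀ (O₁ : ValuationSubring K) (hOO₁ : O ≤ O₁), ringKrullDim (locAtCentre B.toSubring O₁) = 2 →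
    ∃ (B' : Subalgebra k K) (hB'O : B'.toSubring ≤ O.toSubring), B ≤ B' ∧ B'.FG ∧
    IsRegularLocalRing (locAtCentre B'.toSubring O) ∧ ringKrullDim (locAtCentre B'.toSubring O) = 3 ∧
    B'.toSubring ≤ locAtCentre B.toSubring O₁ ∧
    IsRegularLocalRing (↥(locAtCentre B'.toSubring O) ⧸
      subringCentre (locAtCentre B'.toSubring O) O₁ (fun _ hw => hOO₁ (locAtCentre_le hB'O hw))) ∧
    ringKrullDim (↥(locAtCentre B'.toSubring O) ⧸
      subringCentre (locAtCentre B'.toSubring O) O₁ (fun _ hw => hOO₁ (locAtCentre_le hB'O hw))) = 1 :=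
  stub_Cc_curveRegularize_of hEmb

/-- NODE since v2.7 (✓ `Ccurve.centreCurve_of` applied to `stub_Cc_curveRegularize`; formerly SHARED STUB S3, OURS, M, mod F-32 `hEmb`, → porter 2): **the centre
curve made regular, with an adapted regular system of parameters, WITHOUT changing the local ring at the centre of `O₁`.**  For a model `B` (f.g., inside `O`,
above the base model `A` whose centres are all closed) regular of dimension 3 at the centre `P` of `O`, and a coarsening `O₁` of `O` whose centre on `locAtCentre B O`
has height 2 (`ringKrullDim (locAtCentre B O₁) = 2`): a model `B′ ⊇ B` inside `O`, regular of dimension 3 at the centre of `O`, with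
`locAtCentre B′ O₁ = locAtCentre B O₁`, and `x, y, z` generating the maximal ideal of `S′ = locAtCentre B′ O` such that the centre of `O₁` on `S′` is EXACTLY
`(x, y)`.  Algebra (landed): a prime with regular one-dimensional quotient in a regular local ring of dimension 3 is cut out by two members of a regular system of
parameters (✓ `Ccurve.exists_rsp_of_quotient_regular`, Matsumura 14.2). [folklore] -/
theorem stub_Cc_centreCurve (hEmb : CossartJannsenSaito2020Embedded.{0}) :
    ∀ (k : Type) [Field k] (K : Type) [Field K] [Algebra k K]
    (O : ValuationSubring K) (A : Subalgebra k K), A.toSubring ≤ O.toSubring → A.FG → IsFractionRing A K → ringKrullDim A ≤ 3 →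
    (∀ (T : Subring K) (hT : T ≤ O.toSubring), A.toSubring ≤ T → (subringCentre T O hT).IsMaximal) →
    ∀ (B : Subalgebra k K) (hBO : B.toSubring ≤ O.toSubring), A ≤ B → B.FG →
    IsRegularLocalRing (locAtCentre B.toSubring O) → ringKrullDim (locAtCentre B.toSubring O) = 3 →
    ∀ (O₁ : ValuationSubring K), O ≤ O₁ → ringKrullDim (locAtCentre B.toSubring O₁) = 2 →
    ∃ (B' : Subalgebra k K) (hB'O : B'.toSubring ≤ O.toSubring), B ≤ B' ∧ B'.FG ∧
    IsRegularLocalRing (locAtCentre B'.toSubring O) ∧ ringKrullDim (locAtCentre B'.toSubring O) = 3 ∧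
    locAtCentre B'.toSubring O₁ = locAtCentre B.toSubring O₁ ∧
    ∃ (x y z : K) (hx : x ∈ locAtCentre B'.toSubring O) (hy : y ∈ locAtCentre B'.toSubring O) (hz : z ∈ locAtCentre B'.toSubring O),
      (haveI := isLocalRing_locAtCentre hB'O; IsLocalRing.maximalIdeal (locAtCentre B'.toSubring O)) =
        Ideal.span {⟨x, hx⟩, ⟨y, hy⟩, ⟨z, hz⟩} ∧
      ∀ w : ↥(locAtCentre B'.toSubring O), O₁.valuation (w : K) < 1 ↔ w ∈ Ideal.span {(⟨x, hx⟩ : ↥(locAtCentre B'.toSubring O)), ⟨y, hy⟩} :=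
  centreCurve_of (stub_Cc_curveRegularize hEmb)

/-- NODE since v2.6 (✓ `Ccurve.pointPrep_weak`, lead g6; formerly SHARED STUB S5₀, OURS, S–M, no printed input, → porter 3; RESHAPED v2.6 to the landed weak form:
the three fields `B′ ≤ B″` (now `A ≤ B″`), `locAtCentre B″ O₁ = locAtCentre B′ O₁` and the new-centre characterisation were dropped — no consumer of record needs them:
`persistForm2_of` ✓p731030 uses exactly this form, porter 1 (persistForm3) confirmed porch l.276; a porter needing more proves it in its own file): **`n` point blow-ups
along `O` at a point of the regular centre curve.**  In the output situation of `stub_Cc_centreCurve` (r.s.p. `(x, y, z)` of `S′ = locAtCentre B′ O`, centre of `O₁` on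
`S′` = `(x, y)` — so `z` is an `O₁`-unit and `x, y` are infinitely `O`-deeper than `z`), for every `n` there is a model `B″ ⊇ A` inside `O`, regular of dimension 3 at
the centre of `O`, dominating `S′`, with r.s.p. `(x / z^n, y / z^n, z)`.  Route: twice ✓ `exists_model_rsop_div_pow` with `(t, t₂, t₃) := (x, z, y)` then `(y, z, x/z^n)`,
depth `∀ m, v x < v z^{m+1}` from `v₁ x < 1 = v₁ z` along `O ≤ O₁`. [folklore] -/
theorem stub_Cc_pointPrep :
    ∀ (k : Type) [Field k] (K : Type) [Field K] [Algebra k K]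
    (O : ValuationSubring K) (A : Subalgebra k K), A.toSubring ≤ O.toSubring → A.FG → IsFractionRing A K → ringKrullDim A ≤ 3 →
    (∀ (T : Subring K) (hT : T ≤ O.toSubring), A.toSubring ≤ T → (subringCentre T O hT).IsMaximal) →
    ∀ (B' : Subalgebra k K) (hB'O : B'.toSubring ≤ O.toSubring), A ≤ B' → B'.FG →
    IsRegularLocalRing (locAtCentre B'.toSubring O) → ringKrullDim (locAtCentre B'.toSubring O) = 3 →
    ∀ (O₁ : ValuationSubring K), O ≤ O₁ →
    ∀ (x y z : K) (hx : x ∈ locAtCentre B'.toSubring O) (hy : y ∈ locAtCentre B'.toSubring O) (hz : z ∈ locAtCentre B'.toSubring O),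
      (haveI := isLocalRing_locAtCentre hB'O; IsLocalRing.maximalIdeal (locAtCentre B'.toSubring O)) =
        Ideal.span {⟨x, hx⟩, ⟨y, hy⟩, ⟨z, hz⟩} →
      (∀ w : ↥(locAtCentre B'.toSubring O), O₁.valuation (w : K) < 1 ↔ w ∈ Ideal.span {(⟨x, hx⟩ : ↥(locAtCentre B'.toSubring O)), ⟨y, hy⟩}) →
    ∀ n : ℕ,
    ∃ (B'' : Subalgebra k K) (hB''O : B''.toSubring ≤ O.toSubring), A ≤ B'' ∧ B''.FG ∧
    IsRegularLocalRing (locAtCentre B''.toSubring O) ∧ ringKrullDim (locAtCentre B''.toSubring O) = 3 ∧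
    locAtCentre B'.toSubring O ≤ locAtCentre B''.toSubring O ∧
    ∃ (h₁ : x / z ^ n ∈ locAtCentre B''.toSubring O) (h₂ : y / z ^ n ∈ locAtCentre B''.toSubring O) (h₃ : z ∈ locAtCentre B''.toSubring O),
      (haveI := isLocalRing_locAtCentre hB''O; IsLocalRing.maximalIdeal (locAtCentre B''.toSubring O)) =
        Ideal.span {⟨_, h₁⟩, ⟨_, h₂⟩, ⟨_, h₃⟩} :=
  pointPrep_weak

/-- NODE since v2.8 (✓ `Ccurve.lift_of` applied to the S3 node; formerly STUB S2+S3+S4, OURS, M–L, mod F-32 `hEmb` through S3; plan §1 S2–S4): **the lift** — a 2-dimensional regular local ring `R₁` dominating `locAtCentre B O₁` (regular of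
dimension 2, fraction field `K`) and dominated by `O₁` is `locAtCentre B′ O₁` for some model `B′ ⊇ B` inside `O`, regular of dimension 3 at the centre of `O`.
Route: ✓ `AbhyankarQuadraticFactorization_holds` (`R₁` is reached by finitely many quadratic transforms along `O₁`, ✓ `IsQuadraticTransform.along`); each
quadratic transform of `locAtCentre B O₁` is realized by: F-32 on the centre CURVE `C` of `v₁` in `Spec B` (an isomorphism at the generic point of `C`, so
`locAtCentre · O₁` is unchanged; `C` becomes regular at the centre of `O`, with `𝔭_C = (x, y)` for an r.s.p. `(x, y, z)`), then the blow-up of `B` along the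
regular `C`, `v`-chart (✓ `isRegularRing_curveChart` / `curveChart_step`; its local ring at the centre of `O₁` is THE quadratic transform, by
✓ `IsQuadraticTransformAlong.unique`); point/curve blow-ups keep the model finitely generated, inside `O`, above `A`. [folklore] -/
theorem stub_Cc_lift (hEmb : CossartJannsenSaito2020Embedded.{0}) :
    ∀ (p : ℕ), p.Prime →
    ∀ (k : Type) [Field k] [CharP k p] [PerfectField k] (K : Type) [Field K] [Algebra k K]
    (O : ValuationSubring K) (A : Subalgebra k K), A.toSubring ≤ O.toSubring → A.FG → IsFractionRing A K →
    ringKrullDim A ≤ 3 → IsRegularLocalRing (locAtCentre A.toSubring O) →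
    ringKrullDim (locAtCentre A.toSubring O) = 3 →
    (∀ (T : Subring K) (hT : T ≤ O.toSubring), A.toSubring ≤ T → (subringCentre T O hT).IsMaximal) →
    ∀ g₀ : K, (∀ c : K, c ^ p ≠ g₀) →
    ¬ (∃ (O₁ : ValuationSubring K), O ≤ O₁ ∧ O₁ ≠ ⊤ ∧ ∃ y : Fin 2 → K, (∀ i, y i ∈ O) ∧
      ∀ P : MvPolynomial (Fin 2) k, P ≠ 0 → O₁.valuation (MvPolynomial.aeval y P) = 1) →
    ∀ (O₁ : ValuationSubring K), O ≤ O₁ → O₁ ≠ O → O₁ ≠ ⊤ →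
    ∀ (B : Subalgebra k K), B.toSubring ≤ O.toSubring → A ≤ B → B.FG →
    IsRegularLocalRing (locAtCentre B.toSubring O) → ringKrullDim (locAtCentre B.toSubring O) = 3 →
    IsRegularLocalRing (locAtCentre B.toSubring O₁) → ringKrullDim (locAtCentre B.toSubring O₁) = 2 →
    IsLocalRingOf (locAtCentre B.toSubring O₁) →
    ∀ (R₁ : Subring K), R₁ ≤ O₁.toSubring → SubringDominates (locAtCentre B.toSubring O₁) R₁ → SubringDominates R₁ O₁.toSubring →
    IsRegularLocalRing ↥R₁ → ringKrullDim ↥R₁ = 2 →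
    ∃ (B' : Subalgebra k K), B'.toSubring ≤ O.toSubring ∧ B ≤ B' ∧ B'.FG ∧
    IsRegularLocalRing (locAtCentre B'.toSubring O) ∧ ringKrullDim (locAtCentre B'.toSubring O) = 3 ∧
    locAtCentre B'.toSubring O₁ = R₁ :=
  lift_of (stub_Cc_centreCurve hEmb)

/-- NODE (kernel, v2): the v1 stub `liftedD2` from `stub_Cc_rebaseD2` and `stub_Cc_lift` (transport of the clean representative along the EQUALITY
`locAtCentre B′ O₁ = R₁`). [folklore] -/
theorem liftedD2_of_stubs (hCP : CossartPiltant2019.{0}) (hEmb : CossartJannsenSaito2020Embedded.{0}) :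
    ∀ (p : ℕ), p.Prime →
    ∀ (k : Type) [Field k] [CharP k p] [PerfectField k] (K : Type) [Field K] [Algebra k K]
    (O : ValuationSubring K) (A : Subalgebra k K), A.toSubring ≤ O.toSubring → A.FG → IsFractionRing A K →
    ringKrullDim A ≤ 3 → IsRegularLocalRing (locAtCentre A.toSubring O) →
    ringKrullDim (locAtCentre A.toSubring O) = 3 →
    (∀ (T : Subring K) (hT : T ≤ O.toSubring), A.toSubring ≤ T → (subringCentre T O hT).IsMaximal) →
    ∀ g₀ : K, (∀ c : K, c ^ p ≠ g₀) →
    ¬ (∃ (O₁ : ValuationSubring K), O ≤ O₁ ∧ O₁ ≠ ⊤ ∧ ∃ y : Fin 2 → K, (∀ i, y i ∈ O) ∧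
      ∀ P : MvPolynomial (Fin 2) k, P ≠ 0 → O₁.valuation (MvPolynomial.aeval y P) = 1) →
    ∀ (O₁ : ValuationSubring K), O ≤ O₁ → O₁ ≠ O → O₁ ≠ ⊤ →
    ∃ (B : Subalgebra k K), B.toSubring ≤ O.toSubring ∧ A ≤ B ∧ B.FG ∧
    IsRegularLocalRing (locAtCentre B.toSubring O) ∧ ringKrullDim (locAtCentre B.toSubring O) = 3 ∧
    ringKrullDim ↥(locAtCentre B.toSubring O₁) = 2 ∧
    ∃ (_ : IsRegularLocalRing ↥(locAtCentre B.toSubring O₁)) (c : Fin p → K), (∃ j : Fin p, (j : ℕ) ≠ 0 ∧ c j ≠ 0) ∧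
    ((∃ (d m : ℕ) (hmd : m ≤ d) (t : Fin d → ↥(locAtCentre B.toSubring O₁)) (a : Fin m → ℕ) (u : ↥(locAtCentre B.toSubring O₁)), IsUnit u ∧
    Ideal.span (Set.range t) = IsLocalRing.maximalIdeal ↥(locAtCentre B.toSubring O₁) ∧
    ringKrullDim ↥(locAtCentre B.toSubring O₁) = (d : WithBot ℕ∞) ∧ 0 < m ∧ (∀ i, ¬ p ∣ a i) ∧
    (∑ j : Fin p, c j ^ p * g₀ ^ (j : ℕ)) = (u : K) * ∏ i : Fin m, ((t (Fin.castLE hmd i) : ↥(locAtCentre B.toSubring O₁)) : K) ^ (a i)) ∨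
    (∃ u : ↥(locAtCentre B.toSubring O₁), IsUnit u ∧ (∑ j : Fin p, c j ^ p * g₀ ^ (j : ℕ)) = (u : K) ∧
    ∀ c' : ↥(locAtCentre B.toSubring O₁), u - c' ^ p ∉ IsLocalRing.maximalIdeal ↥(locAtCentre B.toSubring O₁)) ∨
    (∃ s c' : ↥(locAtCentre B.toSubring O₁), (∑ j : Fin p, c j ^ p * g₀ ^ (j : ℕ)) = (s : K) ∧
    s - c' ^ p ∈ IsLocalRing.maximalIdeal ↥(locAtCentre B.toSubring O₁) ∧
    s - c' ^ p ∉ IsLocalRing.maximalIdeal ↥(locAtCentre B.toSubring O₁) ^ 2)) := by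
  intro p hp k _ _ _ K _ _ O A hAO hAfg hfrac hdimA hreg hdim3 hzd g₀ hg₀ hdiv O₁ hOO₁ hne hO₁
  obtain ⟨B, hBO, hAB, hBfg, hBreg, hBdim, hB1reg, hB1dim, hB1of, R₁, hR₁O₁, hdom, hdom₁, hR₁dim, hR₁reg, c, hc, hforms⟩ :=
    stub_Cc_rebaseD2 hCP p hp k K O A hAO hAfg hfrac hdimA hreg hdim3 hzd g₀ hg₀ hdiv O₁ hOO₁ hne hO₁
  obtain ⟨B', hB'O, hBB', hB'fg, hB'reg, hB'dim, hloc⟩ :=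
    stub_Cc_lift hEmb p hp k K O A hAO hAfg hfrac hdimA hreg hdim3 hzd g₀ hg₀ hdiv O₁ hOO₁ hne hO₁ B hBO hAB hBfg hBreg hBdim hB1reg hB1dim hB1of
      R₁ hR₁O₁ hdom hdom₁ hR₁reg hR₁dim
  refine ⟨B', hB'O, hAB.trans hBB', hB'fg, hB'reg, hB'dim, ?_⟩
  rw [hloc]
  exact ⟨hR₁dim, hR₁reg, c, hc, hforms⟩

/-- NODE since v2.9 (✓ `Ccurve.persistForm1_of` applied to the S3 node, lead g7; formerly STUB S5-form (1), OURS, M–L; mod F-32 `hEmb` through S3; plan §1 S3/S5₀/S5b/S5c/S5d): **closed-point persist, form (1)** at `locAtCentre B O₁` (`m ≤ 2` factors `τ_i` with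
exponents prime to `p`, times a unit): F-32 regularizes the centre curve `C` at the centre `P` of `O` (adapted r.s.p. `(x, y, z)`, `𝔭_C = (x, y)`); point
blow-ups along `O` (`x = x_n z^n`, `y = y_n z^n`) make every `v₁`-unit of `B_P` a power of `z` times a unit and turn each `τ_i` into `z^{e_i} ℓ_i` with `ℓ_i` a
regular parameter transversal to `z`; one factor ⇒ form (1); two factors with independent tangents ⇒ form (1); two factors TANGENT ⇒ `g` blow-ups of the
regular curve `Γ = V(x̃, z) ≠ C` (Hermite form of the conormal matrix over the DVR `O_{C,P}`) ⇒ form (1).  CAVEAT (res-B-crit-1 g7, DR-E24 gate (1), TYPED HERE):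
in the tangent case fix the number `n` of preparatory point blow-ups `n ≥ max(e₂ + g + 1, e₁ + g + 2)` BEFORE the `Γ`-rounds, so that `h = n − e₂ ≥ 1` survives all
`g` rounds and `x̃` stays a regular parameter.  Exponents are reduced mod `p` by dividing by `p`-th powers (a `K^p`-rescaling of `c`). [folklore] -/
theorem stub_Cc_persistForm1 (hEmb : CossartJannsenSaito2020Embedded.{0}) :
    ∀ (p : ℕ), p.Prime →
    ∀ (k : Type) [Field k] [CharP k p] [PerfectField k] (K : Type) [Field K] [Algebra k K]
    (O : ValuationSubring K) (A : Subalgebra k K), A.toSubring ≤ O.toSubring → A.FG → IsFractionRing A K →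
    ringKrullDim A ≤ 3 → IsRegularLocalRing (locAtCentre A.toSubring O) →
    ringKrullDim (locAtCentre A.toSubring O) = 3 →
    (∀ (T : Subring K) (hT : T ≤ O.toSubring), A.toSubring ≤ T → (subringCentre T O hT).IsMaximal) →
    ∀ g₀ : K, (∀ c : K, c ^ p ≠ g₀) →
    ¬ (∃ (O₁ : ValuationSubring K), O ≤ O₁ ∧ O₁ ≠ ⊤ ∧ ∃ y : Fin 2 → K, (∀ i, y i ∈ O) ∧
      ∀ P : MvPolynomial (Fin 2) k, P ≠ 0 → O₁.valuation (MvPolynomial.aeval y P) = 1) →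
    ∀ (O₁ : ValuationSubring K), O ≤ O₁ → O₁ ≠ O → O₁ ≠ ⊤ →
    ∀ (B : Subalgebra k K), B.toSubring ≤ O.toSubring → A ≤ B → B.FG →
    IsRegularLocalRing (locAtCentre B.toSubring O) → ringKrullDim (locAtCentre B.toSubring O) = 3 →
    ringKrullDim ↥(locAtCentre B.toSubring O₁) = 2 →
    ∀ (_ : IsRegularLocalRing ↥(locAtCentre B.toSubring O₁)) (c : Fin p → K), (∃ j : Fin p, (j : ℕ) ≠ 0 ∧ c j ≠ 0) →
    (∃ (d m : ℕ) (hmd : m ≤ d) (t : Fin d → ↥(locAtCentre B.toSubring O₁)) (a : Fin m → ℕ) (u : ↥(locAtCentre B.toSubring O₁)), IsUnit u ∧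
    Ideal.span (Set.range t) = IsLocalRing.maximalIdeal ↥(locAtCentre B.toSubring O₁) ∧
    ringKrullDim ↥(locAtCentre B.toSubring O₁) = (d : WithBot ℕ∞) ∧ 0 < m ∧ (∀ i, ¬ p ∣ a i) ∧
    (∑ j : Fin p, c j ^ p * g₀ ^ (j : ℕ)) = (u : K) * ∏ i : Fin m, ((t (Fin.castLE hmd i) : ↥(locAtCentre B.toSubring O₁)) : K) ^ (a i)) →
    ∃ (A' : Subalgebra k K), A'.toSubring ≤ O.toSubring ∧ A ≤ A' ∧ A'.FG ∧
    ∃ (_ : IsRegularLocalRing ↥(locAtCentre A'.toSubring O)) (c : Fin p → K), (∃ j : Fin p, (j : ℕ) ≠ 0 ∧ c j ≠ 0) ∧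
    ((∃ (d m : ℕ) (hmd : m ≤ d) (t : Fin d → ↥(locAtCentre A'.toSubring O)) (a : Fin m → ℕ) (u : ↥(locAtCentre A'.toSubring O)), IsUnit u ∧
    Ideal.span (Set.range t) = IsLocalRing.maximalIdeal ↥(locAtCentre A'.toSubring O) ∧
    ringKrullDim ↥(locAtCentre A'.toSubring O) = (d : WithBot ℕ∞) ∧ 0 < m ∧ (∀ i, ¬ p ∣ a i) ∧
    (∑ j : Fin p, c j ^ p * g₀ ^ (j : ℕ)) = (u : K) * ∏ i : Fin m, ((t (Fin.castLE hmd i) : ↥(locAtCentre A'.toSubring O)) : K) ^ (a i)) ∨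
    (∃ u : ↥(locAtCentre A'.toSubring O), IsUnit u ∧ (∑ j : Fin p, c j ^ p * g₀ ^ (j : ℕ)) = (u : K) ∧
    ∀ c' : ↥(locAtCentre A'.toSubring O), u - c' ^ p ∉ IsLocalRing.maximalIdeal ↥(locAtCentre A'.toSubring O)) ∨
    (∃ s c' : ↥(locAtCentre A'.toSubring O), (∑ j : Fin p, c j ^ p * g₀ ^ (j : ℕ)) = (s : K) ∧
    s - c' ^ p ∈ IsLocalRing.maximalIdeal ↥(locAtCentre A'.toSubring O) ∧
    s - c' ^ p ∉ IsLocalRing.maximalIdeal ↥(locAtCentre A'.toSubring O) ^ 2)) :=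
  persistForm1_of (stub_Cc_centreCurve hEmb)

/-- NODE since v2.5 (✓ `Ccurve.persistForm2_of` applied to the shared stub S3; formerly STUB S5-form (2), OURS, M; mod F-32 `hEmb` through S3; plan §1 S5a — HERE `PerfectField k` is
used): **closed-point persist, unit case**: the representative is a unit `w`
of `locAtCentre B O₁` whose residue in `κ(C)` is not a `p`-th power.  `κ(C) = κ(𝔭_C)` is finitely generated of tr.deg 1 over the perfect `k`, so
`[κ(C) : κ(C)^p] = p` (✓ `finrank_frobenius_residueField_eq_pow`) with `p`-basis the uniformizer `z̄` of the DVR `O_{C,P}` (after F-32 makes `C` regular at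
`P`): ✓ `Ccurve.exists_sub_pow_eq_unit_mul_pow` gives `c̄` with `w̄ − c̄^p = z̄^i ·` unit, `p ∤ i`; after `n > i` point blow-ups along `O`,
`w − c^p = z^i ·` unit at the centre: form (1) with one factor. [folklore] -/
theorem stub_Cc_persistForm2 (hEmb : CossartJannsenSaito2020Embedded.{0}) :
    ∀ (p : ℕ), p.Prime →
    ∀ (k : Type) [Field k] [CharP k p] [PerfectField k] (K : Type) [Field K] [Algebra k K]
    (O : ValuationSubring K) (A : Subalgebra k K), A.toSubring ≤ O.toSubring → A.FG → IsFractionRing A K →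
    ringKrullDim A ≤ 3 → IsRegularLocalRing (locAtCentre A.toSubring O) →
    ringKrullDim (locAtCentre A.toSubring O) = 3 →
    (∀ (T : Subring K) (hT : T ≤ O.toSubring), A.toSubring ≤ T → (subringCentre T O hT).IsMaximal) →
    ∀ g₀ : K, (∀ c : K, c ^ p ≠ g₀) →
    ¬ (∃ (O₁ : ValuationSubring K), O ≤ O₁ ∧ O₁ ≠ ⊤ ∧ ∃ y : Fin 2 → K, (∀ i, y i ∈ O) ∧
      ∀ P : MvPolynomial (Fin 2) k, P ≠ 0 → O₁.valuation (MvPolynomial.aeval y P) = 1) →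
    ∀ (O₁ : ValuationSubring K), O ≤ O₁ → O₁ ≠ O → O₁ ≠ ⊤ →
    ∀ (B : Subalgebra k K), B.toSubring ≤ O.toSubring → A ≤ B → B.FG →
    IsRegularLocalRing (locAtCentre B.toSubring O) → ringKrullDim (locAtCentre B.toSubring O) = 3 →
    ringKrullDim ↥(locAtCentre B.toSubring O₁) = 2 →
    ∀ (_ : IsRegularLocalRing ↥(locAtCentre B.toSubring O₁)) (c : Fin p → K), (∃ j : Fin p, (j : ℕ) ≠ 0 ∧ c j ≠ 0) →
    (∃ u : ↥(locAtCentre B.toSubring O₁), IsUnit u ∧ (∑ j : Fin p, c j ^ p * g₀ ^ (j : ℕ)) = (u : K) ∧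
    ∀ c' : ↥(locAtCentre B.toSubring O₁), u - c' ^ p ∉ IsLocalRing.maximalIdeal ↥(locAtCentre B.toSubring O₁)) →
    ∃ (A' : Subalgebra k K), A'.toSubring ≤ O.toSubring ∧ A ≤ A' ∧ A'.FG ∧
    ∃ (_ : IsRegularLocalRing ↥(locAtCentre A'.toSubring O)) (c : Fin p → K), (∃ j : Fin p, (j : ℕ) ≠ 0 ∧ c j ≠ 0) ∧
    ((∃ (d m : ℕ) (hmd : m ≤ d) (t : Fin d → ↥(locAtCentre A'.toSubring O)) (a : Fin m → ℕ) (u : ↥(locAtCentre A'.toSubring O)), IsUnit u ∧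
    Ideal.span (Set.range t) = IsLocalRing.maximalIdeal ↥(locAtCentre A'.toSubring O) ∧
    ringKrullDim ↥(locAtCentre A'.toSubring O) = (d : WithBot ℕ∞) ∧ 0 < m ∧ (∀ i, ¬ p ∣ a i) ∧
    (∑ j : Fin p, c j ^ p * g₀ ^ (j : ℕ)) = (u : K) * ∏ i : Fin m, ((t (Fin.castLE hmd i) : ↥(locAtCentre A'.toSubring O)) : K) ^ (a i)) ∨
    (∃ u : ↥(locAtCentre A'.toSubring O), IsUnit u ∧ (∑ j : Fin p, c j ^ p * g₀ ^ (j : ℕ)) = (u : K) ∧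
    ∀ c' : ↥(locAtCentre A'.toSubring O), u - c' ^ p ∉ IsLocalRing.maximalIdeal ↥(locAtCentre A'.toSubring O)) ∨
    (∃ s c' : ↥(locAtCentre A'.toSubring O), (∑ j : Fin p, c j ^ p * g₀ ^ (j : ℕ)) = (s : K) ∧
    s - c' ^ p ∈ IsLocalRing.maximalIdeal ↥(locAtCentre A'.toSubring O) ∧
    s - c' ^ p ∉ IsLocalRing.maximalIdeal ↥(locAtCentre A'.toSubring O) ^ 2)) :=
  persistForm2_of (stub_Cc_centreCurve hEmb)

/-- NODE since v2.9 (✓ `Ccurve.persistForm3_of` applied to the S3 node, lead g7; formerly STUB S5-form (3), OURS, S–M; mod F-32 `hEmb` through S3; plan §1 S5b with `a = 1`): **closed-point persist, form (3)**: `G − c′^p = τ ∈ 𝔪 ∖ 𝔪²` at `locAtCentre B O₁`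
is a regular parameter there, `τ = αx + βy` with `(ᾱ, β̄) ≠ 0` on `C` (regular at `P` after F-32); point blow-ups along `O` give `G − c′^p = z^N · ℓ` with `ℓ` a
regular parameter transversal to `z`: form (1) (or form (3) when `N = 0`). [folklore] -/
theorem stub_Cc_persistForm3 (hEmb : CossartJannsenSaito2020Embedded.{0}) :
    ∀ (p : ℕ), p.Prime →
    ∀ (k : Type) [Field k] [CharP k p] [PerfectField k] (K : Type) [Field K] [Algebra k K]
    (O : ValuationSubring K) (A : Subalgebra k K), A.toSubring ≤ O.toSubring → A.FG → IsFractionRing A K →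
    ringKrullDim A ≤ 3 → IsRegularLocalRing (locAtCentre A.toSubring O) →
    ringKrullDim (locAtCentre A.toSubring O) = 3 →
    (∀ (T : Subring K) (hT : T ≤ O.toSubring), A.toSubring ≤ T → (subringCentre T O hT).IsMaximal) →
    ∀ g₀ : K, (∀ c : K, c ^ p ≠ g₀) →
    ¬ (∃ (O₁ : ValuationSubring K), O ≤ O₁ ∧ O₁ ≠ ⊤ ∧ ∃ y : Fin 2 → K, (∀ i, y i ∈ O) ∧
      ∀ P : MvPolynomial (Fin 2) k, P ≠ 0 → O₁.valuation (MvPolynomial.aeval y P) = 1) →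
    ∀ (O₁ : ValuationSubring K), O ≤ O₁ → O₁ ≠ O → O₁ ≠ ⊤ →
    ∀ (B : Subalgebra k K), B.toSubring ≤ O.toSubring → A ≤ B → B.FG →
    IsRegularLocalRing (locAtCentre B.toSubring O) → ringKrullDim (locAtCentre B.toSubring O) = 3 →
    ringKrullDim ↥(locAtCentre B.toSubring O₁) = 2 →
    ∀ (_ : IsRegularLocalRing ↥(locAtCentre B.toSubring O₁)) (c : Fin p → K), (∃ j : Fin p, (j : ℕ) ≠ 0 ∧ c j ≠ 0) →
    (∃ s c' : ↥(locAtCentre B.toSubring O₁), (∑ j : Fin p, c j ^ p * g₀ ^ (j : ℕ)) = (s : K) ∧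
    s - c' ^ p ∈ IsLocalRing.maximalIdeal ↥(locAtCentre B.toSubring O₁) ∧
    s - c' ^ p ∉ IsLocalRing.maximalIdeal ↥(locAtCentre B.toSubring O₁) ^ 2) →
    ∃ (A' : Subalgebra k K), A'.toSubring ≤ O.toSubring ∧ A ≤ A' ∧ A'.FG ∧
    ∃ (_ : IsRegularLocalRing ↥(locAtCentre A'.toSubring O)) (c : Fin p → K), (∃ j : Fin p, (j : ℕ) ≠ 0 ∧ c j ≠ 0) ∧
    ((∃ (d m : ℕ) (hmd : m ≤ d) (t : Fin d → ↥(locAtCentre A'.toSubring O)) (a : Fin m → ℕ) (u : ↥(locAtCentre A'.toSubring O)), IsUnit u ∧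
    Ideal.span (Set.range t) = IsLocalRing.maximalIdeal ↥(locAtCentre A'.toSubring O) ∧
    ringKrullDim ↥(locAtCentre A'.toSubring O) = (d : WithBot ℕ∞) ∧ 0 < m ∧ (∀ i, ¬ p ∣ a i) ∧
    (∑ j : Fin p, c j ^ p * g₀ ^ (j : ℕ)) = (u : K) * ∏ i : Fin m, ((t (Fin.castLE hmd i) : ↥(locAtCentre A'.toSubring O)) : K) ^ (a i)) ∨
    (∃ u : ↥(locAtCentre A'.toSubring O), IsUnit u ∧ (∑ j : Fin p, c j ^ p * g₀ ^ (j : ℕ)) = (u : K) ∧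
    ∀ c' : ↥(locAtCentre A'.toSubring O), u - c' ^ p ∉ IsLocalRing.maximalIdeal ↥(locAtCentre A'.toSubring O)) ∨
    (∃ s c' : ↥(locAtCentre A'.toSubring O), (∑ j : Fin p, c j ^ p * g₀ ^ (j : ℕ)) = (s : K) ∧
    s - c' ^ p ∈ IsLocalRing.maximalIdeal ↥(locAtCentre A'.toSubring O) ∧
    s - c' ^ p ∉ IsLocalRing.maximalIdeal ↥(locAtCentre A'.toSubring O) ^ 2)) :=
  persistForm3_of (stub_Cc_centreCurve hEmb)

/-- NODE (kernel, v2): the v1 stub `persist` from the three form stubs. [folklore] -/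
theorem persist_of_stubs (hEmb : CossartJannsenSaito2020Embedded.{0}) :
    ∀ (p : ℕ), p.Prime →
    ∀ (k : Type) [Field k] [CharP k p] [PerfectField k] (K : Type) [Field K] [Algebra k K]
    (O : ValuationSubring K) (A : Subalgebra k K), A.toSubring ≤ O.toSubring → A.FG → IsFractionRing A K →
    ringKrullDim A ≤ 3 → IsRegularLocalRing (locAtCentre A.toSubring O) →
    ringKrullDim (locAtCentre A.toSubring O) = 3 →
    (∀ (T : Subring K) (hT : T ≤ O.toSubring), A.toSubring ≤ T → (subringCentre T O hT).IsMaximal) →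
    ∀ g₀ : K, (∀ c : K, c ^ p ≠ g₀) →
    ¬ (∃ (O₁ : ValuationSubring K), O ≤ O₁ ∧ O₁ ≠ ⊤ ∧ ∃ y : Fin 2 → K, (∀ i, y i ∈ O) ∧
      ∀ P : MvPolynomial (Fin 2) k, P ≠ 0 → O₁.valuation (MvPolynomial.aeval y P) = 1) →
    ∀ (O₁ : ValuationSubring K), O ≤ O₁ → O₁ ≠ O → O₁ ≠ ⊤ →
    ∀ (B : Subalgebra k K), B.toSubring ≤ O.toSubring → A ≤ B → B.FG →
    IsRegularLocalRing (locAtCentre B.toSubring O) → ringKrullDim (locAtCentre B.toSubring O) = 3 →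
    ringKrullDim ↥(locAtCentre B.toSubring O₁) = 2 →
    (∃ (_ : IsRegularLocalRing ↥(locAtCentre B.toSubring O₁)) (c : Fin p → K), (∃ j : Fin p, (j : ℕ) ≠ 0 ∧ c j ≠ 0) ∧
    ((∃ (d m : ℕ) (hmd : m ≤ d) (t : Fin d → ↥(locAtCentre B.toSubring O₁)) (a : Fin m → ℕ) (u : ↥(locAtCentre B.toSubring O₁)), IsUnit u ∧
    Ideal.span (Set.range t) = IsLocalRing.maximalIdeal ↥(locAtCentre B.toSubring O₁) ∧
    ringKrullDim ↥(locAtCentre B.toSubring O₁) = (d : WithBot ℕ∞) ∧ 0 < m ∧ (∀ i, ¬ p ∣ a i) ∧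
    (∑ j : Fin p, c j ^ p * g₀ ^ (j : ℕ)) = (u : K) * ∏ i : Fin m, ((t (Fin.castLE hmd i) : ↥(locAtCentre B.toSubring O₁)) : K) ^ (a i)) ∨
    (∃ u : ↥(locAtCentre B.toSubring O₁), IsUnit u ∧ (∑ j : Fin p, c j ^ p * g₀ ^ (j : ℕ)) = (u : K) ∧
    ∀ c' : ↥(locAtCentre B.toSubring O₁), u - c' ^ p ∉ IsLocalRing.maximalIdeal ↥(locAtCentre B.toSubring O₁)) ∨
    (∃ s c' : ↥(locAtCentre B.toSubring O₁), (∑ j : Fin p, c j ^ p * g₀ ^ (j : ℕ)) = (s : K) ∧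
    s - c' ^ p ∈ IsLocalRing.maximalIdeal ↥(locAtCentre B.toSubring O₁) ∧
    s - c' ^ p ∉ IsLocalRing.maximalIdeal ↥(locAtCentre B.toSubring O₁) ^ 2))) →
    ∃ (A' : Subalgebra k K), A'.toSubring ≤ O.toSubring ∧ A ≤ A' ∧ A'.FG ∧
    ∃ (_ : IsRegularLocalRing ↥(locAtCentre A'.toSubring O)) (c : Fin p → K), (∃ j : Fin p, (j : ℕ) ≠ 0 ∧ c j ≠ 0) ∧
    ((∃ (d m : ℕ) (hmd : m ≤ d) (t : Fin d → ↥(locAtCentre A'.toSubring O)) (a : Fin m → ℕ) (u : ↥(locAtCentre A'.toSubring O)), IsUnit u ∧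
    Ideal.span (Set.range t) = IsLocalRing.maximalIdeal ↥(locAtCentre A'.toSubring O) ∧
    ringKrullDim ↥(locAtCentre A'.toSubring O) = (d : WithBot ℕ∞) ∧ 0 < m ∧ (∀ i, ¬ p ∣ a i) ∧
    (∑ j : Fin p, c j ^ p * g₀ ^ (j : ℕ)) = (u : K) * ∏ i : Fin m, ((t (Fin.castLE hmd i) : ↥(locAtCentre A'.toSubring O)) : K) ^ (a i)) ∨
    (∃ u : ↥(locAtCentre A'.toSubring O), IsUnit u ∧ (∑ j : Fin p, c j ^ p * g₀ ^ (j : ℕ)) = (u : K) ∧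
    ∀ c' : ↥(locAtCentre A'.toSubring O), u - c' ^ p ∉ IsLocalRing.maximalIdeal ↥(locAtCentre A'.toSubring O)) ∨
    (∃ s c' : ↥(locAtCentre A'.toSubring O), (∑ j : Fin p, c j ^ p * g₀ ^ (j : ℕ)) = (s : K) ∧
    s - c' ^ p ∈ IsLocalRing.maximalIdeal ↥(locAtCentre A'.toSubring O) ∧
    s - c' ^ p ∉ IsLocalRing.maximalIdeal ↥(locAtCentre A'.toSubring O) ^ 2)) := by
  intro p hp k _ _ _ K _ _ O A hAO hAfg hfrac hdimA hreg hdim3 hzd g₀ hg₀ hdiv O₁ hOO₁ hne hO₁ B hBO hAB hBfg hBreg hBdim hBdim₁ hrep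
  obtain ⟨hreg₁, c, hc, hforms⟩ := hrep
  rcases hforms with h1 | h2 | h3
  · exact stub_Cc_persistForm1 hEmb p hp k K O A hAO hAfg hfrac hdimA hreg hdim3 hzd g₀ hg₀ hdiv O₁ hOO₁ hne hO₁ B hBO hAB hBfg hBreg hBdim hBdim₁
      hreg₁ c hc h1
  · exact stub_Cc_persistForm2 hEmb p hp k K O A hAO hAfg hfrac hdimA hreg hdim3 hzd g₀ hg₀ hdiv O₁ hOO₁ hne hO₁ B hBO hAB hBfg hBreg hBdim hBdim₁
      hreg₁ c hc h2
  · exact stub_Cc_persistForm3 hEmb p hp k K O A hAO hAfg hfrac hdimA hreg hdim3 hzd g₀ hg₀ hdiv O₁ hOO₁ hne hO₁ B hBO hAB hBfg hBreg hBdim hBdim₁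
      hreg₁ c hc h3

/-- **THE (C-curve) TARGET over perfect fields** (kernel-checked composition): clean local uniformization of the `K^p`-line of `g₀` at a zero-dimensional valuation
ring `O` with a 3-dimensional regular finitely generated centre, NO divisorial coarsening, and a PROPER coarsening `O₁` (composite of rank 2 with first residue field
of transcendence degree 1), over a PERFECT ground field — modulo F-02 + F-32. [folklore] -/
theorem cleanLU3Defect_of_properCoarsening_perfect (hCP : CossartPiltant2019.{0}) (hEmb : CossartJannsenSaito2020Embedded.{0}) :
    ∀ (p : ℕ), p.Prime →
    ∀ (k : Type) [Field k] [CharP k p] [PerfectField k] (K : Type) [Field K] [Algebra k K]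
    (O : ValuationSubring K) (A : Subalgebra k K), A.toSubring ≤ O.toSubring → A.FG → IsFractionRing A K →
    ringKrullDim A ≤ 3 → IsRegularLocalRing (locAtCentre A.toSubring O) →
    ringKrullDim (locAtCentre A.toSubring O) = 3 →
    (∀ (T : Subring K) (hT : T ≤ O.toSubring), A.toSubring ≤ T → (subringCentre T O hT).IsMaximal) →
    ∀ g₀ : K, (∀ c : K, c ^ p ≠ g₀) →
    ¬ (∃ (O₁ : ValuationSubring K), O ≤ O₁ ∧ O₁ ≠ ⊤ ∧ ∃ y : Fin 2 → K, (∀ i, y i ∈ O) ∧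
      ∀ P : MvPolynomial (Fin 2) k, P ≠ 0 → O₁.valuation (MvPolynomial.aeval y P) = 1) →
    ∀ (O₁ : ValuationSubring K), O ≤ O₁ → O₁ ≠ O → O₁ ≠ ⊤ →
    ∃ (A' : Subalgebra k K), A'.toSubring ≤ O.toSubring ∧ A ≤ A' ∧ A'.FG ∧
    ∃ (_ : IsRegularLocalRing ↥(locAtCentre A'.toSubring O)) (c : Fin p → K), (∃ j : Fin p, (j : ℕ) ≠ 0 ∧ c j ≠ 0) ∧
    ((∃ (d m : ℕ) (hmd : m ≤ d) (t : Fin d → ↥(locAtCentre A'.toSubring O)) (a : Fin m → ℕ) (u : ↥(locAtCentre A'.toSubring O)), IsUnit u ∧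
    Ideal.span (Set.range t) = IsLocalRing.maximalIdeal ↥(locAtCentre A'.toSubring O) ∧
    ringKrullDim ↥(locAtCentre A'.toSubring O) = (d : WithBot ℕ∞) ∧ 0 < m ∧ (∀ i, ¬ p ∣ a i) ∧
    (∑ j : Fin p, c j ^ p * g₀ ^ (j : ℕ)) = (u : K) * ∏ i : Fin m, ((t (Fin.castLE hmd i) : ↥(locAtCentre A'.toSubring O)) : K) ^ (a i)) ∨
    (∃ u : ↥(locAtCentre A'.toSubring O), IsUnit u ∧ (∑ j : Fin p, c j ^ p * g₀ ^ (j : ℕ)) = (u : K) ∧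
    ∀ c' : ↥(locAtCentre A'.toSubring O), u - c' ^ p ∉ IsLocalRing.maximalIdeal ↥(locAtCentre A'.toSubring O)) ∨
    (∃ s c' : ↥(locAtCentre A'.toSubring O), (∑ j : Fin p, c j ^ p * g₀ ^ (j : ℕ)) = (s : K) ∧
    s - c' ^ p ∈ IsLocalRing.maximalIdeal ↥(locAtCentre A'.toSubring O) ∧
    s - c' ^ p ∉ IsLocalRing.maximalIdeal ↥(locAtCentre A'.toSubring O) ^ 2)) := by
  intro p hp k _ _ _ K _ _ O A hAO hAfg hfrac hdimA hreg hdim3 hzd g₀ hg₀ hdiv O₁ hOO₁ hne hO₁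
  obtain ⟨B, hBO, hAB, hBfg, hBreg, hBdim, hBdim₁, hrep⟩ :=
    liftedD2_of_stubs hCP hEmb p hp k K O A hAO hAfg hfrac hdimA hreg hdim3 hzd g₀ hg₀ hdiv O₁ hOO₁ hne hO₁
  exact persist_of_stubs hEmb p hp k K O A hAO hAfg hfrac hdimA hreg hdim3 hzd g₀ hg₀ hdiv O₁ hOO₁ hne hO₁ B hBO hAB hBfg hBreg hBdim hBdim₁ hrep


end Summit.ResolutionOfSingularities.ResolutionOfSingularities.Theorems.RadicialJung.CleanModels.Ccurve

end
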